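import Literature.Geometry.Kaehler.ComplexTorusInvertibleIdealQuotients
import Mathlib.RingTheory.ClassGroup.Basic
import HarnessLib

/-!
# The class group `Cl(End X)` — Mathlib's `ClassGroup` — acts freely on the quotients `X/H(I)`
# (Kieffer 2024, Theorem 2 and §1.4.3; Thm. 1.4.9 for a commutative maximal order — torus level)

For a complex torus `X = ComplexTorus Φ` (`Φ : (ι → ℝ) ≃L[ℝ] E`, `End(X) = endRingInt Φ ⊆ M_ι(ℤ)`,
`End⁰(X) = endAlgRat Φ ⊆ M_ι(ℚ)`) whose endomorphism ring is a COMMUTATIVE DOMAIN — read through a ring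
isomorphism `e : endRingInt Φ ≃+* R` onto a Mathlib `CommRing R` with `IsDomain R` (for instance the tree's
`quotientEndEquivRingOfIntegersOfPrimitive`, `End ≃+* 𝓞 K` for a primitive CM type) — this file identifies
the objects of the sequel `ComplexTorusInvertibleIdealQuotients` (invertible ideals `IsInvertibleIdeal`,
equivalence of ideals `IdealEquiv`, the quotients `X/H(I) = quotientByPeriod Φ (kernelSubgroup Φ I)`) with
Mathlib's `FractionalIdeal R⁰ K` / `ClassGroup R`, and restates the FREENESS half of

> "**Theorem 2** (The CM action). […] Let `R = End(A)`, and assume further that `R` is a maximal order or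
> that `A` is an elliptic curve. Then the subset of this isogeny class consisting of abelian varieties `B`
> such that `End(B) = R` is a principal homogeneous space under the class group `Cl(R)` of `R`. Invertible
> `R`-ideals act as isogenies" [Kieffer2024IsogenyGraphs, p. 2]
>
> "First, we explain why the class group of `End(A)` acts freely on abelian varieties in the isogeny class
> with endomorphism ring `R`. Let `I` be an invertible ideal in `R`. By Proposition 1.4.7, the endomorphism
> ring of `A/H(I)` is still `R`; by Proposition 1.4.6, `A/H(I)` (up to isomorphism) does not depend on the
> class of `I` in the class group, and `A/H(I) ≃ A` if and only if `I` lies in the trivial class"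
> [Kieffer2024IsogenyGraphs, §1.4.3, p. 47]

in Mathlib's words: `Cl(R) = ClassGroup R` ("The class group `Cl(R)` of an order `R` is the group (under
ideal multiplication) of invertible ideals of `R` modulo the subgroup of principal fractional `R`-ideals.
In other references, `Cl(R)` is called the Picard group of `R`"; "A fractional `R`-ideal `I` is called
invertible if `I(I:R) = R`" [ArpinMarsegliaSpringer2025, §2, p. 7]; "**Proposition 6.10.** […] `Cl(S)`
acts freely by `I`-multiplication on the set of isomorphism classes of abelian varieties `B` […] with
`S = End(B)`" [ArpinMarsegliaSpringer2025, p. 15]) gives a well-defined INJECTIVE map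
`quotientClass e : ClassGroup R → {complex tori on E}/≅`, `[I] ↦ [X/H(I)]`.

For a MAXIMAL commutative order (`IsDedekindDomain R`) every nonzero ideal is invertible, whence the
commutative case of

> "**Theorem 1.4.9.** Let `A` be an abelian variety over a finite field `k`, and assume that `End(A)` is a
> maximal order. Then every ideal `I` of `End(A)` is a kernel ideal, […] and the endomorphism ring of
> `A/H(I)` is also maximal." [Kieffer2024IsogenyGraphs, §1.4.2, p. 46]

at torus level, for EVERY complex torus whose endomorphism ring is a Dedekind domain.

## Contents (namespace `Literature.Geometry.Kaehler.ComplexTorus`)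

* §0 `End(X)` a commutative domain: `endRingInt_mul_comm_of_ringEquiv`, `endAlgRat_mul_comm_of_comm` /
  `endAlgRat_mul_comm_of_ringEquiv` (`End⁰(X)` is commutative), `endRingInt_mul_eq_zero_iff_of_ringEquiv`,
  **`det_ne_zero_of_ne_zero_of_ringEquiv`** / `isIsogeny_of_ne_zero_of_ringEquiv` (a nonzero endomorphism is an isogeny).
* §1 `IsInvertibleIdeal.exists_ideal_mul_eq_span_intCast`, `isInvertibleIdeal_of_mul_eq_span`,
  **`isInvertibleIdeal_iff_exists_ideal_mul_eq_span`** (`I` invertible ⟺ `I·J = End(X)·r` for an ideal `J`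
  and an isogeny `r`); §1′ `isUnit_coeIdeal_iff_exists_mul_eq_span` (pure algebra),
  **`isInvertibleIdeal_iff_isUnit_coeIdeal`** (`⟺ IsUnit ((I.map e : Ideal R) : FractionalIdeal R⁰ K)`).
* §2 **`idealEquiv_iff_exists_span_singleton_mul_eq`** (`I ~ J ⟺ (x)·I = (y)·J` for isogenies `x, y`);
  §2′ **`classGroup_mk_eq_mk_iff_idealEquiv`**, **`classGroup_mk_eq_mk_iff_isIsomorphic`**,
  `classGroup_mk_eq_one_iff_isIsomorphic_self` (`[I] = [J]` in `ClassGroup R` `⟺ I ~ J ⟺ X/H(I) ≅ X/H(J)`).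
* §3 `isoSetoid` (isomorphism classes of the complex tori `(ι → ℝ) ≃L[ℝ] E`), `repIdeal`, `torusOfUnit`,
  `isIsomorphic_torusOfUnit_iff`, **`quotientClass e : ClassGroup R → Quotient (isoSetoid ι E)`**,
  `quotientClass_mk`, **`quotientClass_injective`** (freeness), `quotientClass_one`,
  `quotientClass_eq_mk_self_iff`, `exists_quotientClass_eq_mk`.
* §4 `[IsDedekindDomain R]`: **`isInvertibleIdeal_of_ne_bot`**, **`isKernelIdeal_of_ne_bot`**,
  `finite_kernelSubgroup_of_ne_bot`, `quotientEndEquivOfNeBot` (+ `map_symm_quotientEndEquivOfNeBot`),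
  `exists_quotientClass_eq`; §4′ `[IsPrincipalIdealRing R]`: `isIsomorphic_quotient_self_of_isPrincipalIdealRing`.

No named facts are introduced (five definitions with bodies — `isoSetoid`, `repIdeal`, `torusOfUnit`,
`quotientClass`, `quotientEndEquivOfNeBot` — and proved theorems only).

## References

* [Kieffer2024IsogenyGraphs] J. Kieffer, *Isogeny graphs of abelian varieties over finite fields* (lecture
  notes, 2024), Theorem 2 (p. 2), §1.4.1 (equivalent ideals, Prop. 1.4.6; p. 45), §1.4.2 Thm. 1.4.9
  (p. 46), §1.4.3 "Sketch of proof of Theorem 2" (p. 47).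
* [ArpinMarsegliaSpringer2025] S. Arpin, S. Marseglia, C. Springer, *Isogeny graphs of abelian varieties and
  singular ideals in orders* (arXiv:2508.03570, 2025), §2 p. 7 (invertible ideals; `Cl(R)` = Picard group)
  and Prop. 6.10 (p. 15) — secondary restatement.
* [Lange2023AbelianVarietiesComplex] H. Lange, *Abelian Varieties over the Complex Numbers* (2023), §1.1.2
  (isogenies, `X/Γ`), §1.1.6 Exercise (5)(b) (isomorphism of complex tori).
-/

noncomputable section

open Module Function
open scoped Matrix nonZeroDivisors

namespace Literature.Geometry.Kaehler

namespace ComplexTorus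

variable {ι : Type*} [Fintype ι] [DecidableEq ι] {E : Type*} [NormedAddCommGroup E] [NormedSpace ℂ E]
  (Φ : (ι → ℝ) ≃L[ℝ] E)

/-! ## Casts (plumbing) -/

omit [DecidableEq ι] in
/-- Entrywise cast `ℤ → ℚ` of a product. [folklore] -/
private theorem map_intCast_mul_rat (A B : Matrix ι ι ℤ) :
    (A * B).map (Int.cast : ℤ → ℚ) = A.map (Int.cast : ℤ → ℚ) * B.map (Int.cast : ℤ → ℚ) :=
  Matrix.map_mul (f := Int.castRingHom ℚ)

omit [Fintype ι] [DecidableEq ι] in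
/-- Entrywise cast `ℤ → ℚ` of a finite sum. [folklore] -/
private theorem map_intCast_sum_rat {κ : Type*} (s : Finset κ) (M : κ → Matrix ι ι ℤ) :
    (∑ k ∈ s, M k).map (Int.cast : ℤ → ℚ) = ∑ k ∈ s, (M k).map (Int.cast : ℤ → ℚ) :=
  map_sum ((Int.castAddHom ℚ).mapMatrix : Matrix ι ι ℤ →+ Matrix ι ι ℚ) M s

/-- `(Σ_k r_k σ_k)_ℚ = Σ_k (r_k)_ℚ (σ_k)_ℚ`. [folklore] -/
private theorem coe_sum_mul_map {κ : Type*} (s : Finset κ) (r σ : κ → endRingInt Φ) :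
    ((∑ k ∈ s, r k * σ k : endRingInt Φ) : Matrix ι ι ℤ).map (Int.cast : ℤ → ℚ) =
      ∑ k ∈ s, (r k : Matrix ι ι ℤ).map (Int.cast : ℤ → ℚ) * (σ k : Matrix ι ι ℤ).map (Int.cast : ℤ → ℚ) := by
  rw [AddSubmonoidClass.coe_finsetSum, map_intCast_sum_rat]
  exact Finset.sum_congr rfl fun k _ ↦ by rw [Subring.coe_mul, map_intCast_mul_rat]

/-- `End(X) → M_ι(ℚ)` is injective. [folklore] -/
private theorem eq_of_map_intCast_eq {α β : endRingInt Φ}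
    (h : (α : Matrix ι ι ℤ).map (Int.cast : ℤ → ℚ) = (β : Matrix ι ι ℤ).map (Int.cast : ℤ → ℚ)) : α = β :=
  Subtype.ext (Matrix.map_injective (Int.cast_injective (α := ℚ)) h)

/-- `([d])_ℚ = d • 1` for the integer `d ∈ End(X)`. [folklore] -/
private theorem map_intCast_coe_intCast (d : ℤ) :
    (((d : endRingInt Φ)) : Matrix ι ι ℤ).map (Int.cast : ℤ → ℚ) = (d : ℚ) • (1 : Matrix ι ι ℚ) := by
  rw [SubringClass.coe_intCast, Matrix.map_intCast Int.cast_zero, ← Matrix.smul_one_eq_diagonal, Int.cast_id]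

omit [DecidableEq ι] in
/-- **Clearing denominators, simultaneously**: finitely many rational matrices have a common denominator
`d ∈ ℤ ∖ 0`. [folklore] -/
private theorem exists_intMatrix_map_eq_smul_family {n : ℕ} (x : Fin n → Matrix ι ι ℚ) :
    ∃ d : ℤ, d ≠ 0 ∧ ∀ k, ∃ A : Matrix ι ι ℤ, A.map (Int.cast : ℤ → ℚ) = (d : ℚ) • x k := by
  obtain ⟨⟨d, hd⟩, h⟩ := IsLocalization.exist_integer_multiples_of_finite (nonZeroDivisors ℤ)
    fun p : Fin n × ι × ι ↦ x p.1 p.2.1 p.2.2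
  choose m hm using fun p ↦ RingHom.mem_rangeS.mp (h p)
  refine ⟨d, nonZeroDivisors.ne_zero hd, fun k ↦ ⟨Matrix.of fun i j ↦ m (k, i, j), ?_⟩⟩
  ext i j
  have hij : (m (k, i, j) : ℚ) = d * x k i j := by
    rw [← zsmul_eq_mul, ← hm (k, i, j)]
    rfl
  rw [Matrix.map_apply, Matrix.of_apply, hij, Matrix.smul_apply, smul_eq_mul]

/-- A single rational endomorphism is `d⁻¹ α_ℚ` with `α ∈ End(X)`, `d ∈ ℤ ∖ 0`. [folklore] -/
private theorem exists_coe_map_eq_smul {M : Matrix ι ι ℚ} (hM : M ∈ endAlgRat Φ) :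
    ∃ d : ℤ, d ≠ 0 ∧ ∃ α : endRingInt Φ, (α : Matrix ι ι ℤ).map (Int.cast : ℤ → ℚ) = (d : ℚ) • M := by
  obtain ⟨d, hd, hA⟩ := exists_intMatrix_map_eq_smul_family (fun _ : Fin 1 ↦ M)
  obtain ⟨A, hA⟩ := hA 0
  have hAend : A ∈ endRingInt Φ := by
    rw [mem_endRingInt_iff, hA]
    exact (endAlgRat Φ).smul_mem hM _
  exact ⟨d, hd, ⟨A, hAend⟩, hA⟩

/-- `det [d] = d^{|ι|} ≠ 0` for an integer `d ≠ 0`. [folklore] -/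
private theorem det_coe_intCast_ne_zero {d : ℤ} (hd : d ≠ 0) : (((d : endRingInt Φ)) : Matrix ι ι ℤ).det ≠ 0 := by
  intro h0
  have h : ((((d : endRingInt Φ) : Matrix ι ι ℤ).det : ℤ) : ℚ) ≠ 0 := by
    rw [Int.cast_det, map_intCast_coe_intCast, Matrix.det_smul, Matrix.det_one, mul_one]
    exact pow_ne_zero _ (Int.cast_ne_zero.2 hd)
  exact h (by rw [h0, Int.cast_zero])

/-! ## §0 `End(X)` a commutative domain, read through `e : End(X) ≃+* R` -/

section CommDomain

variable {Φ}
variable {R : Type*} [CommRing R]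

/-- Commutativity of `End(X)`, read through `e`. [cite: Kieffer2024IsogenyGraphs, §1.4.3 (sketch of proof of Theorem 2: "When `End⁰(A)` is commutative"), p. 47] -/
theorem endRingInt_mul_comm_of_ringEquiv (e : endRingInt Φ ≃+* R) (α β : endRingInt Φ) : α * β = β * α :=
  e.injective (by rw [map_mul, map_mul, mul_comm])

/-- **`End⁰(X) = End(X) ⊗ ℚ` is commutative when `End(X)` is** (every rational endomorphism is `d⁻¹α_ℚ`).
[cite: Kieffer2024IsogenyGraphs, §1.4.3 (sketch of proof of Theorem 2: "When `End⁰(A)` is commutative, then we can identify endomorphism rings of all abelian varieties isogenous to `A` as subrings of `End⁰(A)`"), p. 47] -/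
theorem endAlgRat_mul_comm_of_comm (hc : ∀ α β : endRingInt Φ, α * β = β * α) :
    ∀ M ∈ endAlgRat Φ, ∀ N ∈ endAlgRat Φ, M * N = N * M := by
  intro M hM N hN
  obtain ⟨d, hd, α, hα⟩ := exists_coe_map_eq_smul Φ hM
  obtain ⟨d', hd', β, hβ⟩ := exists_coe_map_eq_smul Φ hN
  have hαβ : (α : Matrix ι ι ℤ).map (Int.cast : ℤ → ℚ) * (β : Matrix ι ι ℤ).map (Int.cast : ℤ → ℚ) =
      (β : Matrix ι ι ℤ).map (Int.cast : ℤ → ℚ) * (α : Matrix ι ι ℤ).map (Int.cast : ℤ → ℚ) := by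
    rw [← map_intCast_mul_rat, ← map_intCast_mul_rat, ← Subring.coe_mul, ← Subring.coe_mul, hc]
  rw [hα, hβ, smul_mul_smul_comm, smul_mul_smul_comm, mul_comm (d' : ℚ)] at hαβ
  have hdd : ((d : ℚ) * d') ≠ 0 := mul_ne_zero (Int.cast_ne_zero.2 hd) (Int.cast_ne_zero.2 hd')
  exact smul_right_injective (Matrix ι ι ℚ) hdd hαβ

/-- `End⁰(X)` is commutative, read through `e : End(X) ≃+* R`.
[cite: Kieffer2024IsogenyGraphs, §1.4.3 (sketch of proof of Theorem 2: "When `End⁰(A)` is commutative"), p. 47] -/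
theorem endAlgRat_mul_comm_of_ringEquiv (e : endRingInt Φ ≃+* R) :
    ∀ M ∈ endAlgRat Φ, ∀ N ∈ endAlgRat Φ, M * N = N * M :=
  endAlgRat_mul_comm_of_comm (endRingInt_mul_comm_of_ringEquiv e)

variable [IsDomain R]

/-- `End(X)` has no zero divisors (read through `e`). [cite: Kieffer2024IsogenyGraphs, Theorem 2 ("`F = End⁰(A)` is a CM field"), p. 2] -/
theorem endRingInt_mul_eq_zero_iff_of_ringEquiv (e : endRingInt Φ ≃+* R) {α β : endRingInt Φ} :
    α * β = 0 ↔ α = 0 ∨ β = 0 := by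
  rw [← e.map_eq_zero_iff, map_mul, mul_eq_zero, e.map_eq_zero_iff, e.map_eq_zero_iff]

/-- **In a domain `End(X)` every nonzero endomorphism is an isogeny** (`det α ≠ 0`): left multiplication
by `α_ℚ` on the finite-dimensional `ℚ`-algebra `End⁰(X)` is injective, hence surjective, so `α_ℚ` is a unit
of `M_ι(ℚ)`. [cite: Kieffer2024IsogenyGraphs, Theorem 2 ("`F = End⁰(A) = End(A) ⊗ ℚ` is a CM field … Invertible `R`-ideals act as isogenies"), p. 2] -/
theorem det_ne_zero_of_ne_zero_of_ringEquiv (e : endRingInt Φ ≃+* R) {α : endRingInt Φ} (hα : α ≠ 0) :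
    (α : Matrix ι ι ℤ).det ≠ 0 := by
  set a : endAlgRat Φ := ⟨(α : Matrix ι ι ℤ).map (Int.cast : ℤ → ℚ), (mem_endRingInt_iff Φ).1 α.2⟩ with ha
  haveI : FiniteDimensional ℚ (endAlgRat Φ) :=
    FiniteDimensional.of_injective (endAlgRat Φ).val.toLinearMap Subtype.val_injective
  -- left multiplication by `a` is injective on `End⁰(X)`
  have hinj : Function.Injective (LinearMap.mulLeft ℚ a) := by
    refine (injective_iff_map_eq_zero _).2 fun M hM ↦ ?_
    rw [LinearMap.mulLeft_apply] at hM
    obtain ⟨d, hd, β, hβ⟩ := exists_coe_map_eq_smul Φ M.2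
    have hαβ : α * β = 0 := by
      apply eq_of_map_intCast_eq Φ
      rw [Subring.coe_mul, map_intCast_mul_rat, hβ, Matrix.mul_smul, ZeroMemClass.coe_zero,
        Matrix.map_zero _ Int.cast_zero]
      have h0 : (a : Matrix ι ι ℚ) * (M : Matrix ι ι ℚ) = 0 := congrArg Subtype.val hM
      rw [ha] at h0
      rw [h0, smul_zero]
    have hβ0 : β = 0 := ((endRingInt_mul_eq_zero_iff_of_ringEquiv e).1 hαβ).resolve_left hα
    rw [hβ0, ZeroMemClass.coe_zero, Matrix.map_zero _ Int.cast_zero] at hβ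
    have hM0 : (M : Matrix ι ι ℚ) = 0 :=
      (smul_eq_zero.1 hβ.symm).resolve_left (Int.cast_ne_zero.2 hd)
    exact Subtype.ext hM0
  obtain ⟨M, hM⟩ := (LinearMap.injective_iff_surjective.1 hinj) 1
  rw [LinearMap.mulLeft_apply] at hM
  have h1 : (a : Matrix ι ι ℚ) * (M : Matrix ι ι ℚ) = 1 := congrArg Subtype.val hM
  have hu : IsUnit ((α : Matrix ι ι ℤ).map (Int.cast : ℤ → ℚ)).det :=
    Matrix.isUnit_det_of_right_inverse h1
  rw [← Int.cast_det, isUnit_iff_ne_zero, Int.cast_ne_zero] at hu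
  exact hu

/-- A nonzero endomorphism of a torus with domain `End(X)` is an isogeny `X → X`.
[cite: Kieffer2024IsogenyGraphs, Theorem 2 ("Invertible `R`-ideals act as isogenies"), p. 2] -/
theorem isIsogeny_of_ne_zero_of_ringEquiv (e : endRingInt Φ ≃+* R) {α : endRingInt Φ} (hα : α ≠ 0) :
    IsIsogeny Φ Φ (α : Matrix ι ι ℤ) :=
  isIsogeny_of_mem_endRingInt Φ α.2 (det_ne_zero_of_ne_zero_of_ringEquiv e hα)

/-- The index type of a torus with domain `End(X)` is nonempty (`End(X) ≅ R` is nontrivial). [folklore] -/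
private theorem nonempty_index_of_ringEquiv (e : endRingInt Φ ≃+* R) : Nonempty ι := by
  rcases isEmpty_or_nonempty ι with hι | hι
  · haveI : Nontrivial (endRingInt Φ) := e.symm.injective.nontrivial
    exact absurd (Subsingleton.elim (0 : endRingInt Φ) 1) zero_ne_one
  · exact hι

/-- `det α ≠ 0 ⟹ α ≠ 0` (for nonempty `ι`), in the form `e α ≠ 0`. [folklore] -/
private theorem map_ne_zero_of_det_ne_zero (e : endRingInt Φ ≃+* R) {α : endRingInt Φ}
    (hα : (α : Matrix ι ι ℤ).det ≠ 0) : e α ≠ 0 := by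
  haveI := nonempty_index_of_ringEquiv e
  intro h0
  rw [e.map_eq_zero_iff] at h0
  rw [h0, ZeroMemClass.coe_zero, Matrix.det_zero] at hα
  exact hα rfl

end CommDomain

/-! ## §1 Invertible ideals: `I·J = End(X)·r`, and Mathlib's `IsUnit (I : FractionalIdeal R⁰ K)` -/

section Invertible

variable {Φ}

/-- A finite sum of products `Σ_{i<n} τ_i j_i` with `τ_i ∈ I`, `j_i ∈ J` — the shape of an element of `I·J`;
closed under appending. [folklore] -/
private theorem exists_fin_sum_of_mem_mul {I J : Ideal (endRingInt Φ)} {x : endRingInt Φ} (hx : x ∈ I * J) :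
    ∃ (n : ℕ) (τ j : Fin n → endRingInt Φ), (∀ i, τ i ∈ I) ∧ (∀ i, j i ∈ J) ∧ x = ∑ i, τ i * j i := by
  refine Submodule.smul_induction_on hx (fun r hr s hs ↦ ?_) (fun x y ⟨n, τ, j, hτ, hj, hx⟩ ⟨m, τ', j', hτ', hj', hy⟩ ↦ ?_)
  · exact ⟨1, fun _ ↦ r, fun _ ↦ s, fun _ ↦ hr, fun _ ↦ hs, by simp [smul_eq_mul]⟩
  · refine ⟨n + m, Fin.append τ τ', Fin.append j j', fun i ↦ ?_, fun i ↦ ?_, ?_⟩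
    · refine Fin.addCases (fun i ↦ ?_) (fun i ↦ ?_) i
      · rw [Fin.append_left]; exact hτ i
      · rw [Fin.append_right]; exact hτ' i
    · refine Fin.addCases (fun i ↦ ?_) (fun i ↦ ?_) i
      · rw [Fin.append_left]; exact hj i
      · rw [Fin.append_right]; exact hj' i
    · rw [Fin.sum_univ_add, hx, hy]
      simp only [Fin.append_left, Fin.append_right]

/-- **An invertible ideal `I` of a commutative `End(X)` satisfies `I·J = End(X)·[d]` for an ideal `J` and an
integer `d ≠ 0`**: clearing the denominators of the `x_k ∈ I♯` (`a_k = d x_k ∈ End(X)`), `J = Σ_k End(X)a_k`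
has `I a_k ⊆ End(X)d` and `d = Σ_k a_k σ_k ∈ I·J` — the condition "`I(I:R) = R`" up to the principal
factor `d`. [cite: Kieffer2024IsogenyGraphs, §1.4.3 (sketch of proof of Theorem 2: "Let `I` be an invertible ideal in `R`"), p. 47] -/
theorem IsInvertibleIdeal.exists_ideal_mul_eq_span_intCast (hc : ∀ α β : endRingInt Φ, α * β = β * α)
    {I : Ideal (endRingInt Φ)} (hI : IsInvertibleIdeal Φ I) :
    ∃ (J : Ideal (endRingInt Φ)) (d : ℤ), d ≠ 0 ∧ I * J = Ideal.span {(d : endRingInt Φ)} := by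
  obtain ⟨n, x, σ, hx, hxI, hσ, hsum⟩ := hI
  obtain ⟨d, hd, hA⟩ := exists_intMatrix_map_eq_smul_family x
  choose A hA using hA
  have hAend : ∀ k, A k ∈ endRingInt Φ := fun k ↦ by
    rw [mem_endRingInt_iff, hA]
    exact (endAlgRat Φ).smul_mem (hx k) _
  set a : Fin n → endRingInt Φ := fun k ↦ ⟨A k, hAend k⟩ with ha_def
  have ha : ∀ k, (a k : Matrix ι ι ℤ).map (Int.cast : ℤ → ℚ) = (d : ℚ) • x k := fun k ↦ hA k
  -- `d = Σ_k a_k σ_k`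
  have heq : (d : endRingInt Φ) = ∑ k, a k * σ k := by
    apply eq_of_map_intCast_eq Φ
    rw [coe_sum_mul_map, map_intCast_coe_intCast]
    calc (d : ℚ) • (1 : Matrix ι ι ℚ) = (d : ℚ) • ∑ k, x k * (σ k : Matrix ι ι ℤ).map (Int.cast : ℤ → ℚ) := by
          rw [hsum]
      _ = ∑ k, (a k : Matrix ι ι ℤ).map (Int.cast : ℤ → ℚ) * (σ k : Matrix ι ι ℤ).map (Int.cast : ℤ → ℚ) := by
          rw [Finset.smul_sum]
          exact Finset.sum_congr rfl fun k _ ↦ by rw [ha, smul_mul_assoc]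
  refine ⟨Ideal.span (Set.range a), d, hd, le_antisymm ?_ ?_⟩
  · -- `I·J ⊆ End(X)d`: on generators `τ a_k = r d` with `r_ℚ = τ_ℚ x_k`
    refine Ideal.mul_le.2 fun τ hτ j hj ↦ ?_
    refine Submodule.span_induction (p := fun j _ ↦ τ * j ∈ Ideal.span {(d : endRingInt Φ)}) ?_ ?_ ?_ ?_ hj
    · rintro _ ⟨k, rfl⟩
      obtain ⟨r, hr⟩ := hxI k τ hτ
      refine Ideal.mem_span_singleton'.2 ⟨r, eq_of_map_intCast_eq Φ ?_⟩
      rw [Subring.coe_mul, Subring.coe_mul, map_intCast_mul_rat, map_intCast_mul_rat, hr, ha,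
        map_intCast_coe_intCast, Matrix.mul_smul, Matrix.mul_one, Matrix.mul_smul]
    · rw [mul_zero]
      exact Submodule.zero_mem _
    · intro y z _ _ hy hz
      rw [mul_add]
      exact Submodule.add_mem _ hy hz
    · intro c y _ hy
      rw [smul_eq_mul, ← mul_assoc, hc τ c, mul_assoc]
      exact Ideal.mul_mem_left _ c hy
  · -- `d = Σ_k a_k σ_k = Σ_k σ_k a_k ∈ I·J`
    rw [Ideal.span_singleton_le_iff_mem, heq]
    exact Ideal.sum_mem _ fun k _ ↦ by
      rw [hc (a k) (σ k)]
      exact Ideal.mul_mem_mul (hσ k) (Ideal.subset_span ⟨k, rfl⟩)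

/-- **Conversely, `I·J = End(X)·r` for an isogeny `r` makes `I` invertible** (commutative `End(X)`): writing
`r = Σ_i τ_i j_i` (`τ_i ∈ I`, `j_i ∈ J`), the elements `x_i = j_{i,ℚ} r_ℚ⁻¹ ∈ End⁰(X)` lie in `I♯`
(`τ j_i ∈ End(X)r`) and `Σ_i x_i τ_i = r r⁻¹ = 1`. [cite: Kieffer2024IsogenyGraphs, §1.4.3 (sketch of proof of Theorem 2) and Theorem 2 ("Invertible `R`-ideals act as isogenies"), pp. 2, 47] -/
theorem isInvertibleIdeal_of_mul_eq_span (hc : ∀ α β : endRingInt Φ, α * β = β * α)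
    {I J : Ideal (endRingInt Φ)} {r : endRingInt Φ} (hr : (r : Matrix ι ι ℤ).det ≠ 0)
    (hIJ : I * J = Ideal.span {r}) : IsInvertibleIdeal Φ I := by
  have hrmem : r ∈ I * J := hIJ ▸ Ideal.mem_span_singleton_self r
  obtain ⟨n, τ, j, hτ, hj, hsum⟩ := exists_fin_sum_of_mem_mul hrmem
  set rQ : Matrix ι ι ℚ := (r : Matrix ι ι ℤ).map (Int.cast : ℤ → ℚ) with hrQ
  have hru : IsUnit rQ.det := by
    rw [hrQ, ← Int.cast_det]
    exact (Int.cast_ne_zero.2 hr).isUnit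
  have hrQmem : rQ ∈ endAlgRat Φ := (mem_endRingInt_iff Φ).1 r.2
  -- `σ_ℚ` commutes with `r_ℚ⁻¹` for `σ ∈ End(X)`
  have hcomm_inv : ∀ σ : endRingInt Φ,
      rQ⁻¹ * (σ : Matrix ι ι ℤ).map (Int.cast : ℤ → ℚ) = (σ : Matrix ι ι ℤ).map (Int.cast : ℤ → ℚ) * rQ⁻¹ := by
    intro σ
    have h : rQ * (σ : Matrix ι ι ℤ).map (Int.cast : ℤ → ℚ) = (σ : Matrix ι ι ℤ).map (Int.cast : ℤ → ℚ) * rQ := by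
      rw [hrQ, ← map_intCast_mul_rat, ← map_intCast_mul_rat, ← Subring.coe_mul, ← Subring.coe_mul, hc]
    calc rQ⁻¹ * (σ : Matrix ι ι ℤ).map (Int.cast : ℤ → ℚ)
        = rQ⁻¹ * ((σ : Matrix ι ι ℤ).map (Int.cast : ℤ → ℚ) * rQ) * rQ⁻¹ := by
          rw [Matrix.mul_assoc, Matrix.mul_nonsing_inv_cancel_right _ _ hru]
      _ = (σ : Matrix ι ι ℤ).map (Int.cast : ℤ → ℚ) * rQ⁻¹ := by
          rw [← h, Matrix.nonsing_inv_mul_cancel_left _ _ hru]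
  refine ⟨n, fun i ↦ (j i : Matrix ι ι ℤ).map (Int.cast : ℤ → ℚ) * rQ⁻¹, τ, fun i ↦ ?_, fun i σ hσ ↦ ?_, hτ, ?_⟩
  · exact (endAlgRat Φ).mul_mem ((mem_endRingInt_iff Φ).1 (j i).2) (inv_mem_endAlgRat Φ hrQmem)
  · -- `σ j_i ∈ I·J = End(X)r`, `σ j_i = c r`, so `σ_ℚ j_{i,ℚ} r⁻¹ = c_ℚ`
    have hmem : σ * j i ∈ Ideal.span {r} := hIJ ▸ Ideal.mul_mem_mul hσ (hj i)
    obtain ⟨c, hc'⟩ := Ideal.mem_span_singleton'.1 hmem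
    refine ⟨c, ?_⟩
    rw [← Matrix.mul_assoc, ← map_intCast_mul_rat, ← Subring.coe_mul, ← hc', Subring.coe_mul,
      map_intCast_mul_rat, Matrix.mul_nonsing_inv_cancel_right _ _ hru]
  · -- `Σ_i j_{i,ℚ} r⁻¹ τ_{i,ℚ} = (Σ_i τ_i j_i)_ℚ r⁻¹ = 1`
    calc ∑ i, (j i : Matrix ι ι ℤ).map (Int.cast : ℤ → ℚ) * rQ⁻¹ * (τ i : Matrix ι ι ℤ).map (Int.cast : ℤ → ℚ)
        = ∑ i, (τ i : Matrix ι ι ℤ).map (Int.cast : ℤ → ℚ) * (j i : Matrix ι ι ℤ).map (Int.cast : ℤ → ℚ) * rQ⁻¹ :=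
          Finset.sum_congr rfl fun i _ ↦ by
            rw [Matrix.mul_assoc, hcomm_inv, ← Matrix.mul_assoc, ← map_intCast_mul_rat, ← Subring.coe_mul,
              hc (j i) (τ i), Subring.coe_mul, map_intCast_mul_rat]
      _ = ((∑ i, τ i * j i : endRingInt Φ) : Matrix ι ι ℤ).map (Int.cast : ℤ → ℚ) * rQ⁻¹ := by
          rw [coe_sum_mul_map, Finset.sum_mul]
      _ = 1 := by rw [← hsum, Matrix.mul_nonsing_inv _ hru]

/-- **Invertibility of an ideal of a commutative `End(X)`, intrinsically: `I` is invertible iff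
`I·J = End(X)·r` for some ideal `J` and some isogeny `r ∈ End(X)`** ("`I(I:R) = R`", the principal ideal
`End(X)·r` standing for `R` inside `End(X) ⊆ End⁰(X)`). [cite: Kieffer2024IsogenyGraphs, §1.4.3 (sketch of proof of Theorem 2: "Let `I` be an invertible ideal in `R`") and Theorem 2, pp. 2, 47] -/
theorem isInvertibleIdeal_iff_exists_ideal_mul_eq_span (hc : ∀ α β : endRingInt Φ, α * β = β * α)
    {I : Ideal (endRingInt Φ)} :
    IsInvertibleIdeal Φ I ↔ ∃ (J : Ideal (endRingInt Φ)) (r : endRingInt Φ),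
      (r : Matrix ι ι ℤ).det ≠ 0 ∧ I * J = Ideal.span {r} := by
  constructor
  · intro hI
    obtain ⟨J, d, hd, hIJ⟩ := hI.exists_ideal_mul_eq_span_intCast hc
    exact ⟨J, d, det_coe_intCast_ne_zero Φ hd, hIJ⟩
  · rintro ⟨J, r, hr, hIJ⟩
    exact isInvertibleIdeal_of_mul_eq_span hc hr hIJ

end Invertible

/-! ## §1′ … and Mathlib's invertible fractional ideals -/

section Fractional

variable {Φ}
variable {R : Type*} [CommRing R] [IsDomain R] (e : endRingInt Φ ≃+* R)
  (K : Type*) [Field K] [Algebra R K] [IsFractionRing R K]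

omit [IsDomain R] in
/-- `Ideal.map e` is injective for a ring isomorphism `e`. [folklore] -/
private theorem map_injective_of_ringEquiv : Function.Injective (Ideal.map e : Ideal (endRingInt Φ) → Ideal R) :=
  fun I J h ↦ by rw [← Ideal.comap_map_of_bijective e e.bijective (I := I), h, Ideal.comap_map_of_bijective e e.bijective]

/-- **An integral ideal `I′` of a domain `R` is invertible as a fractional ideal iff `I′J′ = (s)` for some
ideal `J′` and some `s ≠ 0`** ("A fractional `R`-ideal `I` is called invertible if `I(I:R) = R`"; here with
the denominator of `(I:R)` cleared: `J′ = s(I′:R) ⊆ R`). [cite: ArpinMarsegliaSpringer2025, §2, p. 7] -/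
theorem isUnit_coeIdeal_iff_exists_mul_eq_span {I' : Ideal R} :
    IsUnit (I' : FractionalIdeal R⁰ K) ↔ ∃ (J' : Ideal R) (s : R), s ≠ 0 ∧ I' * J' = Ideal.span {s} := by
  constructor
  · rintro ⟨u, hu⟩
    obtain ⟨a, aJ, ha, haJ⟩ := FractionalIdeal.exists_eq_spanSingleton_mul (↑u⁻¹ : FractionalIdeal R⁰ K)
    have haK : algebraMap R K a ≠ 0 := IsFractionRing.to_map_ne_zero_of_mem_nonZeroDivisors
      (mem_nonZeroDivisors_of_ne_zero ha)
    refine ⟨aJ, a, ha, FractionalIdeal.coeIdeal_injective (K := K) ?_⟩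
    change ((I' * aJ : Ideal R) : FractionalIdeal R⁰ K) = ((Ideal.span {a} : Ideal R) : FractionalIdeal R⁰ K)
    have haJ' : (aJ : FractionalIdeal R⁰ K) = FractionalIdeal.spanSingleton R⁰ (algebraMap R K a) * ↑u⁻¹ := by
      rw [haJ, ← mul_assoc, FractionalIdeal.spanSingleton_mul_spanSingleton, mul_inv_cancel₀ haK,
        FractionalIdeal.spanSingleton_one, one_mul]
    rw [FractionalIdeal.coeIdeal_mul, FractionalIdeal.coeIdeal_span_singleton, ← hu, haJ', mul_left_comm,
      Units.mul_inv, mul_one]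
  · rintro ⟨J', s, hs, h⟩
    have hsK : algebraMap R K s ≠ 0 := IsFractionRing.to_map_ne_zero_of_mem_nonZeroDivisors
      (mem_nonZeroDivisors_of_ne_zero hs)
    have hprod : (I' : FractionalIdeal R⁰ K) * (J' : FractionalIdeal R⁰ K) =
        FractionalIdeal.spanSingleton R⁰ (algebraMap R K s) := by
      rw [← FractionalIdeal.coeIdeal_mul, h, FractionalIdeal.coeIdeal_span_singleton]
    have hunit : IsUnit (FractionalIdeal.spanSingleton R⁰ (algebraMap R K s)) :=
      IsUnit.of_mul_eq_one (FractionalIdeal.spanSingleton R⁰ (algebraMap R K s)⁻¹) (by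
        rw [FractionalIdeal.spanSingleton_mul_spanSingleton, mul_inv_cancel₀ hsK,
          FractionalIdeal.spanSingleton_one])
    rw [← hprod] at hunit
    exact isUnit_of_mul_isUnit_left hunit

/-- **Invertible ideals of `End(X)` are exactly Mathlib's invertible fractional ideals**: for a complex torus
whose endomorphism ring is a commutative domain, read through `e : End(X) ≃+* R`, an ideal `I ⊆ End(X)` is
invertible (`IsInvertibleIdeal`, "`1 ∈ I♯·I`") iff `e(I)` is a unit of the monoid of fractional ideals of `R`
in its fraction field `K` — i.e. iff its class lives in "the class group `Cl(R)`" `= ClassGroup R` ("the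
group of invertible ideals of `R` modulo the subgroup of principal fractional `R`-ideals … the Picard group
of `R`"). [cite: Kieffer2024IsogenyGraphs, Theorem 2 ("a principal homogeneous space under the class group `Cl(R)` of `R`. Invertible `R`-ideals act as isogenies") and §1.4.3 ("Let `I` be an invertible ideal in `R`"), pp. 2, 47] [cite: ArpinMarsegliaSpringer2025, §2 ("A fractional `R`-ideal `I` is called invertible if `I(I:R) = R` … The class group `Cl(R)` … is called the Picard group of `R`"), p. 7] -/
theorem isInvertibleIdeal_iff_isUnit_coeIdeal {I : Ideal (endRingInt Φ)} :
    IsInvertibleIdeal Φ I ↔ IsUnit ((I.map e : Ideal R) : FractionalIdeal R⁰ K) := by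
  rw [isInvertibleIdeal_iff_exists_ideal_mul_eq_span (endRingInt_mul_comm_of_ringEquiv e),
    isUnit_coeIdeal_iff_exists_mul_eq_span]
  constructor
  · rintro ⟨J, r, hr, hIJ⟩
    refine ⟨J.map e, e r, map_ne_zero_of_det_ne_zero e hr, ?_⟩
    rw [← Ideal.map_mul, hIJ, Ideal.map_span, Set.image_singleton]
  · rintro ⟨J', s, hs, h⟩
    have hs' : e.symm s ≠ 0 := (EmbeddingLike.map_ne_zero_iff).2 hs
    refine ⟨J'.comap e, e.symm s, det_ne_zero_of_ne_zero_of_ringEquiv e hs', map_injective_of_ringEquiv e ?_⟩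
    rw [Ideal.map_mul, Ideal.map_comap_of_surjective e e.surjective, h, Ideal.map_span, Set.image_singleton,
      RingEquiv.apply_symm_apply]

/-- The unit of `FractionalIdeal R⁰ K` of an invertible ideal: its value is `e(I)`.
[cite: Kieffer2024IsogenyGraphs, Theorem 2 ("Invertible `R`-ideals"), p. 2] -/
theorem IsInvertibleIdeal.coe_unit_eq {I : Ideal (endRingInt Φ)} (hI : IsInvertibleIdeal Φ I) :
    ((((isInvertibleIdeal_iff_isUnit_coeIdeal e K).1 hI).unit : (FractionalIdeal R⁰ K)ˣ) : FractionalIdeal R⁰ K) =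
      ((I.map e : Ideal R) : FractionalIdeal R⁰ K) :=
  IsUnit.unit_spec _

end Fractional

/-! ## §2 Equivalent ideals = equal classes in `ClassGroup R`; `X/H(I) ≅ X/H(J) ⟺ [I] = [J]` -/

section Classes

variable {Φ}

/-- `z ∈ End(X)y · I ⟺ z = y i` for some `i ∈ I` (commutative `End(X)`). [folklore] -/
private theorem mem_span_singleton_mul_iff (hc : ∀ α β : endRingInt Φ, α * β = β * α)
    {I : Ideal (endRingInt Φ)} {y z : endRingInt Φ} :
    z ∈ Ideal.span {y} * I ↔ ∃ i ∈ I, z = y * i := by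
  constructor
  · intro hz
    refine Submodule.smul_induction_on hz (fun r hr s hs ↦ ?_) (fun a b ⟨i, hi, ha⟩ ⟨i', hi', hb⟩ ↦ ?_)
    · obtain ⟨c, rfl⟩ := Ideal.mem_span_singleton'.1 hr
      exact ⟨c * s, I.mul_mem_left c hs, by rw [smul_eq_mul, ← mul_assoc, hc c y, mul_assoc]⟩
    · exact ⟨i + i', I.add_mem hi hi', by rw [ha, hb, mul_add]⟩
  · rintro ⟨i, hi, rfl⟩
    exact Ideal.mul_mem_mul (Ideal.mem_span_singleton_self y) hi

/-- **Equivalence of ideals, integrally: `I ~ J` (`I_ℚ = J_ℚ λ`, `λ ∈ End⁰(X)ˣ`) iff `End(X)x · I = End(X)y · J`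
for isogenies `x, y ∈ End(X)`** (`λ = y x⁻¹`; conversely `λ = d⁻¹ y_ℚ`, `x = [d]`) — for a commutative
`End(X)`; this is the relation "modulo the subgroup of principal fractional `R`-ideals" defining `Cl(R)`.
[cite: Kieffer2024IsogenyGraphs, §1.4.1 ("we call two ideals `I` and `J` equivalent if `I = Jλ` for some `λ ∈ End⁰(A)`", p. 45) and Theorem 2 ("the class group `Cl(R)`", p. 2)] -/
theorem idealEquiv_iff_exists_span_singleton_mul_eq (hc : ∀ α β : endRingInt Φ, α * β = β * α)
    {I J : Ideal (endRingInt Φ)} :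
    IdealEquiv Φ I J ↔ ∃ x y : endRingInt Φ, (x : Matrix ι ι ℤ).det ≠ 0 ∧ (y : Matrix ι ι ℤ).det ≠ 0 ∧
      Ideal.span {x} * I = Ideal.span {y} * J := by
  have hcQ := endAlgRat_mul_comm_of_comm hc
  constructor
  · rintro ⟨L, hL, hLu, hIJ⟩
    obtain ⟨d, hd, y, hy⟩ := exists_coe_map_eq_smul Φ hL
    have hydet : (y : Matrix ι ι ℤ).det ≠ 0 := by
      intro h0
      have h : ((y : Matrix ι ι ℤ).map (Int.cast : ℤ → ℚ)).det = 0 := by rw [← Int.cast_det, h0, Int.cast_zero]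
      rw [hy, Matrix.det_smul] at h
      exact (mul_ne_zero (pow_ne_zero _ (Int.cast_ne_zero.2 hd)) hLu.ne_zero) h
    refine ⟨d, y, det_coe_intCast_ne_zero Φ hd, hydet, ?_⟩
    ext z
    rw [mem_span_singleton_mul_iff hc, mem_span_singleton_mul_iff hc]
    constructor
    · rintro ⟨i, hi, rfl⟩
      -- `i_ℚ = j_ℚ L`, so `d i = j y = y j`
      have hiQ : (i : Matrix ι ι ℤ).map (Int.cast : ℤ → ℚ) ∈ (· * L) '' idealRat Φ J :=
        hIJ ▸ (coe_mem_idealRat_iff Φ).2 hi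
      obtain ⟨_, hjQ, hij⟩ := hiQ
      obtain ⟨j, hj, rfl⟩ := (mem_idealRat_iff Φ).1 hjQ
      refine ⟨j, hj, eq_of_map_intCast_eq Φ ?_⟩
      dsimp only at hij
      rw [Subring.coe_mul, Subring.coe_mul, map_intCast_mul_rat, map_intCast_mul_rat, map_intCast_coe_intCast,
        ← hij, smul_mul_assoc, Matrix.one_mul, ← Matrix.mul_smul, ← hy, ← map_intCast_mul_rat,
        ← map_intCast_mul_rat, ← Subring.coe_mul, ← Subring.coe_mul, hc]
    · rintro ⟨j, hj, rfl⟩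
      have hjL : (j : Matrix ι ι ℤ).map (Int.cast : ℤ → ℚ) * L ∈ idealRat Φ I :=
        hIJ ▸ ⟨_, (coe_mem_idealRat_iff Φ).2 hj, rfl⟩
      obtain ⟨i, hi, hiQ⟩ := (mem_idealRat_iff Φ).1 hjL
      refine ⟨i, hi, eq_of_map_intCast_eq Φ ?_⟩
      rw [Subring.coe_mul, Subring.coe_mul, map_intCast_mul_rat, map_intCast_mul_rat, map_intCast_coe_intCast,
        hiQ, smul_mul_assoc, Matrix.one_mul, ← Matrix.mul_smul, ← hy, ← map_intCast_mul_rat,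
        ← map_intCast_mul_rat, ← Subring.coe_mul, ← Subring.coe_mul, hc]
  · rintro ⟨x, y, hx, hy, h⟩
    set xQ : Matrix ι ι ℚ := (x : Matrix ι ι ℤ).map (Int.cast : ℤ → ℚ) with hxQ
    set yQ : Matrix ι ι ℚ := (y : Matrix ι ι ℤ).map (Int.cast : ℤ → ℚ) with hyQ
    have hxu : IsUnit xQ.det := by
      rw [hxQ, ← Int.cast_det]
      exact (Int.cast_ne_zero.2 hx).isUnit
    have hyu : IsUnit yQ.det := by
      rw [hyQ, ← Int.cast_det]
      exact (Int.cast_ne_zero.2 hy).isUnit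
    have hxmem : xQ ∈ endAlgRat Φ := (mem_endRingInt_iff Φ).1 x.2
    have hymem : yQ ∈ endAlgRat Φ := (mem_endRingInt_iff Φ).1 y.2
    have hxinv : xQ⁻¹ ∈ endAlgRat Φ := inv_mem_endAlgRat Φ hxmem
    refine ⟨yQ * xQ⁻¹, (endAlgRat Φ).mul_mem hymem hxinv, ?_, ?_⟩
    · rw [Matrix.det_mul]
      exact hyu.mul (Matrix.isUnit_nonsing_inv_det _ hxu)
    · ext M
      constructor
      · intro hM
        obtain ⟨i, hi, rfl⟩ := (mem_idealRat_iff Φ).1 hM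
        -- `x i = y j`
        have hxi : x * i ∈ Ideal.span {y} * J := h ▸ (mem_span_singleton_mul_iff hc).2 ⟨i, hi, rfl⟩
        obtain ⟨j, hj, hxij⟩ := (mem_span_singleton_mul_iff hc).1 hxi
        refine ⟨(j : Matrix ι ι ℤ).map (Int.cast : ℤ → ℚ), (coe_mem_idealRat_iff Φ).2 hj, ?_⟩
        dsimp only
        -- `j_ℚ (y_ℚ x⁻¹) = (y j)_ℚ x⁻¹ = (x i)_ℚ x⁻¹ = i_ℚ`
        rw [← Matrix.mul_assoc, hcQ _ ((mem_endRingInt_iff Φ).1 j.2) _ hymem, hyQ, ← map_intCast_mul_rat,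
          ← Subring.coe_mul, ← hxij, Subring.coe_mul, map_intCast_mul_rat, ← hxQ,
          hcQ _ hxmem _ ((mem_endRingInt_iff Φ).1 i.2), Matrix.mul_nonsing_inv_cancel_right _ _ hxu]
      · rintro ⟨_, hjM, rfl⟩
        obtain ⟨j, hj, rfl⟩ := (mem_idealRat_iff Φ).1 hjM
        have hyj : y * j ∈ Ideal.span {x} * I := h.symm ▸ (mem_span_singleton_mul_iff hc).2 ⟨j, hj, rfl⟩
        obtain ⟨i, hi, hyji⟩ := (mem_span_singleton_mul_iff hc).1 hyj
        refine (mem_idealRat_iff Φ).2 ⟨i, hi, ?_⟩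
        dsimp only
        rw [← Matrix.mul_assoc, hcQ _ ((mem_endRingInt_iff Φ).1 j.2) _ hymem, hyQ, ← map_intCast_mul_rat,
          ← Subring.coe_mul, hyji, Subring.coe_mul, map_intCast_mul_rat, ← hxQ,
          hcQ _ hxmem _ ((mem_endRingInt_iff Φ).1 i.2), Matrix.mul_nonsing_inv_cancel_right _ _ hxu]

end Classes

/-! ## §2′ `[I] = [J]` in `ClassGroup R` ⟺ `I ~ J` ⟺ `X/H(I) ≅ X/H(J)` -/

section ClassGroupClasses

variable {Φ}
variable {R : Type*} [CommRing R] [IsDomain R] (e : endRingInt Φ ≃+* R)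
  (K : Type*) [Field K] [Algebra R K] [IsFractionRing R K]

/-- `ClassGroup.mk_eq_mk_of_coe_ideal` for an arbitrary fraction field `K` (Mathlib states it for
`FractionRing R`). [folklore] -/
private theorem classGroup_mk_eq_mk_iff_of_coe_ideal {u v : (FractionalIdeal R⁰ K)ˣ} {I' J' : Ideal R}
    (hu : (u : FractionalIdeal R⁰ K) = I') (hv : (v : FractionalIdeal R⁰ K) = J') :
    ClassGroup.mk K u = ClassGroup.mk K v ↔
      ∃ x y : R, x ≠ 0 ∧ y ≠ 0 ∧ Ideal.span {x} * I' = Ideal.span {y} * J' := by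
  rw [← ClassGroup.mk_canonicalEquiv K (FractionRing R) u, ← ClassGroup.mk_canonicalEquiv K (FractionRing R) v]
  refine ClassGroup.mk_eq_mk_of_coe_ideal ?_ ?_
  · rw [Units.coe_map, MonoidHom.coe_coe, hu, FractionalIdeal.canonicalEquiv_coeIdeal]
  · rw [Units.coe_map, MonoidHom.coe_coe, hv, FractionalIdeal.canonicalEquiv_coeIdeal]

/-- **Equivalent ideals are the ideals with the same class in `Cl(End X) = ClassGroup R`**: for invertible
ideals `I, J ⊆ End(X)` with units `u = e(I)`, `v = e(J)` of `FractionalIdeal R⁰ K`, `[u] = [v]` in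
`ClassGroup R` iff `I ~ J` ("`A/H(I)` (up to isomorphism) does not depend on the class of `I` in the class
group"). [cite: Kieffer2024IsogenyGraphs, §1.4.3 (sketch of proof of Theorem 2) with §1.4.1 (equivalent ideals), pp. 45, 47] -/
theorem classGroup_mk_eq_mk_iff_idealEquiv {I J : Ideal (endRingInt Φ)} {u v : (FractionalIdeal R⁰ K)ˣ}
    (hu : (u : FractionalIdeal R⁰ K) = ((I.map e : Ideal R) : FractionalIdeal R⁰ K))
    (hv : (v : FractionalIdeal R⁰ K) = ((J.map e : Ideal R) : FractionalIdeal R⁰ K)) :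
    ClassGroup.mk K u = ClassGroup.mk K v ↔ IdealEquiv Φ I J := by
  rw [classGroup_mk_eq_mk_iff_of_coe_ideal K hu hv,
    idealEquiv_iff_exists_span_singleton_mul_eq (endRingInt_mul_comm_of_ringEquiv e)]
  constructor
  · rintro ⟨x, y, hx, hy, h⟩
    refine ⟨e.symm x, e.symm y, det_ne_zero_of_ne_zero_of_ringEquiv e ((EmbeddingLike.map_ne_zero_iff).2 hx),
      det_ne_zero_of_ne_zero_of_ringEquiv e ((EmbeddingLike.map_ne_zero_iff).2 hy), map_injective_of_ringEquiv e ?_⟩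
    rw [Ideal.map_mul, Ideal.map_mul, Ideal.map_span, Ideal.map_span, Set.image_singleton, Set.image_singleton,
      RingEquiv.apply_symm_apply, RingEquiv.apply_symm_apply, h]
  · rintro ⟨x, y, hx, hy, h⟩
    refine ⟨e x, e y, map_ne_zero_of_det_ne_zero e hx, map_ne_zero_of_det_ne_zero e hy, ?_⟩
    have h' := congrArg (Ideal.map e) h
    rwa [Ideal.map_mul, Ideal.map_mul, Ideal.map_span, Ideal.map_span, Set.image_singleton,
      Set.image_singleton] at h'

/-- **FREENESS of the class-group action: `X/H(I) ≅ X/H(J) ⟺ [I] = [J]` in `ClassGroup R`** (`u = e(I)`,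
`v = e(J)` the invertible fractional ideals; "by Proposition 1.4.6, `A/H(I)` (up to isomorphism) does not
depend on the class of `I` in the class group" and conversely, invertible ideals being kernel ideals).
[cite: Kieffer2024IsogenyGraphs, §1.4.3 (sketch of proof of Theorem 2) with §1.4.1 Prop. 1.4.6, pp. 45, 47] -/
theorem classGroup_mk_eq_mk_iff_isIsomorphic {I J : Ideal (endRingInt Φ)} {u v : (FractionalIdeal R⁰ K)ˣ}
    (hu : (u : FractionalIdeal R⁰ K) = ((I.map e : Ideal R) : FractionalIdeal R⁰ K))
    (hv : (v : FractionalIdeal R⁰ K) = ((J.map e : Ideal R) : FractionalIdeal R⁰ K))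
    [Finite (kernelSubgroup Φ I)] [Finite (kernelSubgroup Φ J)] :
    ClassGroup.mk K u = ClassGroup.mk K v ↔
      IsIsomorphic (quotientByPeriod Φ (kernelSubgroup Φ I)) (quotientByPeriod Φ (kernelSubgroup Φ J)) := by
  have hI : IsInvertibleIdeal Φ I := (isInvertibleIdeal_iff_isUnit_coeIdeal e K).2 (hu ▸ u.isUnit)
  have hJ : IsInvertibleIdeal Φ J := (isInvertibleIdeal_iff_isUnit_coeIdeal e K).2 (hv ▸ v.isUnit)
  rw [classGroup_mk_eq_mk_iff_idealEquiv e K hu hv, hI.isIsomorphic_quotient_iff_idealEquiv hJ]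

/-- **"`A/H(I) ≃ A` if and only if `I` lies in the trivial class"**: `X/H(I) ≅ X ⟺ [I] = 1` in `ClassGroup R`.
[cite: Kieffer2024IsogenyGraphs, §1.4.3 (sketch of proof of Theorem 2), p. 47] -/
theorem classGroup_mk_eq_one_iff_isIsomorphic_self {I : Ideal (endRingInt Φ)} {u : (FractionalIdeal R⁰ K)ˣ}
    (hu : (u : FractionalIdeal R⁰ K) = ((I.map e : Ideal R) : FractionalIdeal R⁰ K))
    [Finite (kernelSubgroup Φ I)] :
    ClassGroup.mk K u = 1 ↔ IsIsomorphic (quotientByPeriod Φ (kernelSubgroup Φ I)) Φ := by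
  have h1 : ((1 : (FractionalIdeal R⁰ K)ˣ) : FractionalIdeal R⁰ K) =
      (((⊤ : Ideal (endRingInt Φ)).map e : Ideal R) : FractionalIdeal R⁰ K) := by
    rw [Units.val_one, Ideal.map_top, FractionalIdeal.coeIdeal_top]
  haveI : Finite (kernelSubgroup Φ (⊤ : Ideal (endRingInt Φ))) := by
    rw [kernelSubgroup_top]
    infer_instance
  rw [← map_one (ClassGroup.mk K), classGroup_mk_eq_mk_iff_isIsomorphic e K hu h1]
  exact ⟨fun h ↦ h.trans isIsomorphic_quotientBy_kernelSubgroup_top,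
    fun h ↦ h.trans isIsomorphic_quotientBy_kernelSubgroup_top.symm⟩

end ClassGroupClasses

/-! ## §3 The free action as an injective map `ClassGroup R ↪ {complex tori on E}/≅` -/

section QuotientClass

variable (ι E) in
/-- **Isomorphism classes of the complex tori `E/Ψ(ℤ^ι)`** (period maps `Ψ : (ι → ℝ) ≃L[ℝ] E` up to
`IsIsomorphic`; "abelian varieties … up to isomorphism"). A DEFINITION with a body.
[cite: Kieffer2024IsogenyGraphs, §1.4.3 (Theorem 2: "the set of isomorphism classes", p. 47)] [cite: Lange2023AbelianVarietiesComplex, §1.1.6 Exercise (5)(b), p. 27] -/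
def isoSetoid : Setoid ((ι → ℝ) ≃L[ℝ] E) where
  r := IsIsomorphic
  iseqv := ⟨fun Ψ ↦ IsIsomorphic.refl Ψ, IsIsomorphic.symm, IsIsomorphic.trans⟩

omit [DecidableEq ι] in
/-- Unfolding of the relation of `isoSetoid`. [cite: Lange2023AbelianVarietiesComplex, §1.1.6 Exercise (5)(b), p. 27] -/
theorem isoSetoid_r_iff {Ψ Ψ' : (ι → ℝ) ≃L[ℝ] E} : (isoSetoid ι E).r Ψ Ψ' ↔ IsIsomorphic Ψ Ψ' := Iff.rfl

variable {Φ}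
variable {R : Type*} [CommRing R] [IsDomain R] (e : endRingInt Φ ≃+* R)
  (K : Type*) [Field K] [Algebra R K] [IsFractionRing R K]

omit [IsDomain R] in
/-- A nonzero `x ∈ K` generates an invertible fractional ideal. [folklore] -/
private theorem isUnit_spanSingleton_of_ne_zero {x : K} (hx : x ≠ 0) :
    IsUnit (FractionalIdeal.spanSingleton R⁰ x) :=
  IsUnit.of_mul_eq_one (FractionalIdeal.spanSingleton R⁰ x⁻¹) (by
    rw [FractionalIdeal.spanSingleton_mul_spanSingleton, mul_inv_cancel₀ hx, FractionalIdeal.spanSingleton_one])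

/-- The integral numerator `num u = den(u) · u` of an invertible fractional ideal is invertible. [folklore] -/
private theorem isUnit_coeIdeal_num (u : (FractionalIdeal R⁰ K)ˣ) :
    IsUnit (((u : FractionalIdeal R⁰ K).num : Ideal R) : FractionalIdeal R⁰ K) := by
  rw [← FractionalIdeal.den_mul_self_eq_num' R⁰ K (u : FractionalIdeal R⁰ K)]
  exact (isUnit_spanSingleton_of_ne_zero K
    (IsFractionRing.to_map_ne_zero_of_mem_nonZeroDivisors (SetLike.coe_mem _))).mul u.isUnit

/-- `[num u] = [u]` in `ClassGroup R` (they differ by the principal ideal `(den u)`). [folklore] -/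
private theorem classGroup_mk_unit_num (u : (FractionalIdeal R⁰ K)ˣ) :
    ClassGroup.mk K (isUnit_coeIdeal_num K u).unit = ClassGroup.mk K u := by
  have hden : algebraMap R K ((u : FractionalIdeal R⁰ K).den : R) ≠ 0 :=
    IsFractionRing.to_map_ne_zero_of_mem_nonZeroDivisors (SetLike.coe_mem _)
  have hP : ClassGroup.mk K (toPrincipalIdeal R K (Units.mk0 _ hden)) = 1 :=
    ClassGroup.mk_eq_one_iff.2 ⟨⟨_, by rw [coe_toPrincipalIdeal, Units.val_mk0, FractionalIdeal.coe_spanSingleton]⟩⟩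
  have hunits : (isUnit_coeIdeal_num K u).unit = toPrincipalIdeal R K (Units.mk0 _ hden) * u := by
    ext : 1
    rw [IsUnit.unit_spec, Units.val_mul, coe_toPrincipalIdeal, Units.val_mk0,
      FractionalIdeal.den_mul_self_eq_num']
  rw [hunits, map_mul, hP, one_mul]

/-- **An integral representative of a class, pulled back to `End(X)`**: `I_u = e⁻¹(num u) ⊆ End(X)` for a unit
`u` of `FractionalIdeal R⁰ K` (`num u = den(u) · u`, Mathlib's `FractionalIdeal.num`). A DEFINITION with a
body. [cite: Kieffer2024IsogenyGraphs, §1.4.3 (sketch of proof of Theorem 2: "Let `I` be an invertible ideal in `R`"), p. 47] -/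
def repIdeal (u : (FractionalIdeal R⁰ K)ˣ) : Ideal (endRingInt Φ) :=
  ((u : FractionalIdeal R⁰ K).num).comap e

omit [IsDomain R] [IsFractionRing R K] in
/-- `e(I_u) = num u`. [cite: Kieffer2024IsogenyGraphs, §1.4.3, p. 47] -/
theorem map_repIdeal (u : (FractionalIdeal R⁰ K)ˣ) :
    (repIdeal e K u).map e = (u : FractionalIdeal R⁰ K).num :=
  Ideal.map_comap_of_surjective e e.surjective _

/-- **`I_u` is an invertible ideal of `End(X)`.** [cite: Kieffer2024IsogenyGraphs, §1.4.3 (sketch of proof of Theorem 2), p. 47] -/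
theorem isInvertibleIdeal_repIdeal (u : (FractionalIdeal R⁰ K)ˣ) : IsInvertibleIdeal Φ (repIdeal e K u) :=
  (isInvertibleIdeal_iff_isUnit_coeIdeal e K).2 (by
    rw [map_repIdeal]
    exact isUnit_coeIdeal_num K u)

/-- **The torus `X/H(I_u)` attached to a unit fractional ideal `u`** (its kernel subgroup is finite since `I_u`
is invertible). A DEFINITION with a body. [cite: Kieffer2024IsogenyGraphs, §1.4.3 (sketch of proof of Theorem 2: "Invertible `R`-ideals act as isogenies", with Theorem 2), pp. 2, 47] -/
def torusOfUnit (u : (FractionalIdeal R⁰ K)ˣ) : (ι → ℝ) ≃L[ℝ] E :=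
  haveI := (isInvertibleIdeal_repIdeal e K u).finite_kernelSubgroup
  quotientByPeriod Φ (kernelSubgroup Φ (repIdeal e K u))

/-- `X/H(I_u) ≅ X/H(I_v) ⟺ [u] = [v]` in `ClassGroup R`. [cite: Kieffer2024IsogenyGraphs, §1.4.3 (sketch of proof of Theorem 2), p. 47] -/
theorem isIsomorphic_torusOfUnit_iff {u v : (FractionalIdeal R⁰ K)ˣ} :
    IsIsomorphic (torusOfUnit e K u) (torusOfUnit e K v) ↔ ClassGroup.mk K u = ClassGroup.mk K v := by
  haveI := (isInvertibleIdeal_repIdeal e K u).finite_kernelSubgroup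
  haveI := (isInvertibleIdeal_repIdeal e K v).finite_kernelSubgroup
  rw [← classGroup_mk_unit_num K u, ← classGroup_mk_unit_num K v,
    classGroup_mk_eq_mk_iff_isIsomorphic e K (I := repIdeal e K u) (J := repIdeal e K v)
      (by rw [IsUnit.unit_spec, map_repIdeal]) (by rw [IsUnit.unit_spec, map_repIdeal])]
  exact Iff.rfl

/-- **The class-group action as a map on classes: `Cl(End X) = ClassGroup R → {complex tori on E}/≅`,
`[I] ↦ [X/H(I)]`** — well defined because "`A/H(I)` (up to isomorphism) does not depend on the class of `I`
in the class group" (through the integral representative `I_u` of a class). A DEFINITION with a body.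
[cite: Kieffer2024IsogenyGraphs, Theorem 2 ("Invertible `R`-ideals act as isogenies") and §1.4.3 (sketch of proof), pp. 2, 47] -/
def quotientClass : ClassGroup R → Quotient (isoSetoid ι E) :=
  Quot.lift (fun u : (FractionalIdeal R⁰ (FractionRing R))ˣ ↦ ⟦torusOfUnit e (FractionRing R) u⟧)
    fun u v huv ↦ Quotient.sound ((isIsomorphic_torusOfUnit_iff e (FractionRing R)).2 (by
      rw [← ClassGroup.Quot_mk_eq_mk, ← ClassGroup.Quot_mk_eq_mk]
      exact Quot.sound huv))

/-- Value of `quotientClass` on the class of a unit of `FractionalIdeal R⁰ (FractionRing R)`.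
[cite: Kieffer2024IsogenyGraphs, §1.4.3 (sketch of proof of Theorem 2), p. 47] -/
theorem quotientClass_mk_fractionRing (u : (FractionalIdeal R⁰ (FractionRing R))ˣ) :
    quotientClass e (ClassGroup.mk (FractionRing R) u) = ⟦torusOfUnit e (FractionRing R) u⟧ := by
  rw [← ClassGroup.Quot_mk_eq_mk]
  rfl

/-- **`quotientClass [e(I)] = [X/H(I)]` for every invertible ideal `I ⊆ End(X)`** (any fraction field `K`,
`u` the unit with value `e(I)`). [cite: Kieffer2024IsogenyGraphs, §1.4.3 (sketch of proof of Theorem 2: "by Proposition 1.4.6, `A/H(I)` (up to isomorphism) does not depend on the class of `I`"), p. 47] -/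
theorem quotientClass_mk {I : Ideal (endRingInt Φ)} {u : (FractionalIdeal R⁰ K)ˣ}
    (hu : (u : FractionalIdeal R⁰ K) = ((I.map e : Ideal R) : FractionalIdeal R⁰ K))
    [Finite (kernelSubgroup Φ I)] :
    quotientClass e (ClassGroup.mk K u) = ⟦quotientByPeriod Φ (kernelSubgroup Φ I)⟧ := by
  rw [← ClassGroup.mk_canonicalEquiv K (FractionRing R) u, quotientClass_mk_fractionRing]
  set w : (FractionalIdeal R⁰ (FractionRing R))ˣ :=
    Units.map (↑(FractionalIdeal.canonicalEquiv R⁰ K (FractionRing R))) u with hw_def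
  have hw : (w : FractionalIdeal R⁰ (FractionRing R)) =
      ((I.map e : Ideal R) : FractionalIdeal R⁰ (FractionRing R)) := by
    rw [hw_def, Units.coe_map, MonoidHom.coe_coe, hu, FractionalIdeal.canonicalEquiv_coeIdeal]
  haveI := (isInvertibleIdeal_repIdeal e (FractionRing R) w).finite_kernelSubgroup
  apply Quotient.sound
  change IsIsomorphic (quotientByPeriod Φ (kernelSubgroup Φ (repIdeal e (FractionRing R) w)))
    (quotientByPeriod Φ (kernelSubgroup Φ I))
  rw [← classGroup_mk_eq_mk_iff_isIsomorphic e (FractionRing R)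
    (u := (isUnit_coeIdeal_num (FractionRing R) w).unit) (v := w)
    (by rw [IsUnit.unit_spec, map_repIdeal]) hw, classGroup_mk_unit_num]

/-- **THEOREM 2, freeness, in Mathlib's words: `quotientClass : ClassGroup R → {tori}/≅` is INJECTIVE**
("the class group of `End(A)` acts freely on abelian varieties in the isogeny class with endomorphism ring
`R`"; "`Cl(S)` acts freely by `I`-multiplication on the set of isomorphism classes").
[cite: Kieffer2024IsogenyGraphs, Theorem 2 and §1.4.3 (sketch of proof), pp. 2, 47] [cite: ArpinMarsegliaSpringer2025, Prop. 6.10, p. 15] -/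
theorem quotientClass_injective : Function.Injective (quotientClass e) := fun c d ↦
  ClassGroup.induction (FractionRing R)
    (P := fun c ↦ quotientClass e c = quotientClass e d → c = d)
    (fun u ↦ ClassGroup.induction (FractionRing R)
      (P := fun d ↦ quotientClass e (ClassGroup.mk _ u) = quotientClass e d → ClassGroup.mk _ u = d)
      (fun v h ↦ by
        rw [quotientClass_mk_fractionRing, quotientClass_mk_fractionRing] at h
        exact (isIsomorphic_torusOfUnit_iff e (FractionRing R)).1 (Quotient.exact h)) d) c

/-- **The trivial class acts trivially: `quotientClass 1 = [X]`** (`X/H(End(X)) ≅ X`).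
[cite: Kieffer2024IsogenyGraphs, §1.4.3 (sketch of proof of Theorem 2: "`A/H(I) ≃ A` if and only if `I` lies in the trivial class"), p. 47] -/
theorem quotientClass_one : quotientClass e 1 = ⟦Φ⟧ := by
  haveI : Finite (kernelSubgroup Φ (⊤ : Ideal (endRingInt Φ))) := by
    rw [kernelSubgroup_top]
    infer_instance
  have h1 : ((1 : (FractionalIdeal R⁰ (FractionRing R))ˣ) : FractionalIdeal R⁰ (FractionRing R)) =
      (((⊤ : Ideal (endRingInt Φ)).map e : Ideal R) : FractionalIdeal R⁰ (FractionRing R)) := by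
    rw [Units.val_one, Ideal.map_top, FractionalIdeal.coeIdeal_top]
  rw [← map_one (ClassGroup.mk (FractionRing R)), quotientClass_mk e (FractionRing R) h1]
  exact Quotient.sound isIsomorphic_quotientBy_kernelSubgroup_top

/-- `quotientClass c = [X] ⟺ c = 1`. [cite: Kieffer2024IsogenyGraphs, §1.4.3 (sketch of proof of Theorem 2: "`A/H(I) ≃ A` if and only if `I` lies in the trivial class"), p. 47] -/
theorem quotientClass_eq_mk_self_iff {c : ClassGroup R} : quotientClass e c = ⟦Φ⟧ ↔ c = 1 := by
  rw [← quotientClass_one e]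
  exact ⟨fun h ↦ quotientClass_injective e h, fun h ↦ by rw [h]⟩

/-- Every value of `quotientClass` is the class of some `X/H(I)` with `I` invertible (namely `I = I_u`).
[cite: Kieffer2024IsogenyGraphs, §1.4.3 (sketch of proof of Theorem 2), p. 47] -/
theorem exists_quotientClass_eq_mk (c : ClassGroup R) :
    ∃ (I : Ideal (endRingInt Φ)) (hI : IsInvertibleIdeal Φ I),
      quotientClass e c = (haveI := hI.finite_kernelSubgroup; ⟦quotientByPeriod Φ (kernelSubgroup Φ I)⟧) := by
  refine ClassGroup.induction (FractionRing R) (fun u ↦ ?_) c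
  exact ⟨repIdeal e (FractionRing R) u, isInvertibleIdeal_repIdeal e (FractionRing R) u,
    quotientClass_mk_fractionRing e u⟩

end QuotientClass

/-! ## §4 Maximal commutative orders (`IsDedekindDomain R`): Theorem 1.4.9, commutative case -/

section Dedekind

variable {Φ}
variable {R : Type*} [CommRing R] [IsDedekindDomain R]

/-- **For a maximal commutative order `End(X) ≅ R` (a Dedekind domain) every nonzero ideal of `End(X)` is
invertible** (`FractionalIdeal R⁰ K` is a group with zero). [cite: Kieffer2024IsogenyGraphs, §1.4.2 Thm. 1.4.9 ("assume that `End(A)` is a maximal order") with §1.4.3 (proof of Theorem 2, "`R` maximal"), pp. 46–47] -/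
theorem isInvertibleIdeal_of_ne_bot (e : endRingInt Φ ≃+* R) {I : Ideal (endRingInt Φ)} (hI : I ≠ ⊥) :
    IsInvertibleIdeal Φ I := by
  refine (isInvertibleIdeal_iff_isUnit_coeIdeal e (FractionRing R)).2 (isUnit_iff_ne_zero.2 ?_)
  rw [Ne, FractionalIdeal.coeIdeal_eq_zero]
  intro h
  apply hI
  apply map_injective_of_ringEquiv e
  rw [h, Ideal.map_bot]

/-- **THEOREM 1.4.9, first clause, for a commutative maximal order: every (nonzero) ideal of `End(X)` is a
kernel ideal** — on EVERY complex torus whose endomorphism ring is a Dedekind domain.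
[cite: Kieffer2024IsogenyGraphs, §1.4.2 Thm. 1.4.9 ("Then every ideal `I` of `End(A)` is a kernel ideal"), p. 46] -/
theorem isKernelIdeal_of_ne_bot (e : endRingInt Φ ≃+* R) {I : Ideal (endRingInt Φ)} (hI : I ≠ ⊥) :
    IsKernelIdeal Φ I :=
  (isInvertibleIdeal_of_ne_bot e hI).isKernelIdeal

/-- `H(I)` is finite for every nonzero ideal of a Dedekind `End(X)`. [cite: Kieffer2024IsogenyGraphs, §1.4.2 Thm. 1.4.9, p. 46] -/
theorem finite_kernelSubgroup_of_ne_bot (e : endRingInt Φ ≃+* R) {I : Ideal (endRingInt Φ)} (hI : I ≠ ⊥) :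
    Finite (kernelSubgroup Φ I) :=
  (isInvertibleIdeal_of_ne_bot e hI).finite_kernelSubgroup

/-- **THEOREM 1.4.9, third clause, for a commutative maximal order: `End(X/H(I)) ≅ R` is again the maximal
order** (through `η` and `e`). A DEFINITION with a body. [cite: Kieffer2024IsogenyGraphs, §1.4.2 Thm. 1.4.9 ("the endomorphism ring of `A/H(I)` is also maximal"), p. 46] -/
def quotientEndEquivOfNeBot (e : endRingInt Φ ≃+* R) {I : Ideal (endRingInt Φ)} (hI : I ≠ ⊥)
    [Finite (kernelSubgroup Φ I)] :
    endRingInt (quotientByPeriod Φ (kernelSubgroup Φ I)) ≃+* R :=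
  ((isInvertibleIdeal_of_ne_bot e hI).quotientEndEquiv (endAlgRat_mul_comm_of_ringEquiv e)).trans e

/-- On matrices the isomorphism is `e ∘ η`: `e⁻¹(quotientEndEquivOfNeBot γ)_ℚ = η(γ)`.
[cite: Kieffer2024IsogenyGraphs, §1.4.2 Thm. 1.4.9 with §1.4.1 Prop. 1.4.7, pp. 45–46] -/
theorem map_symm_quotientEndEquivOfNeBot (e : endRingInt Φ ≃+* R) {I : Ideal (endRingInt Φ)} (hI : I ≠ ⊥)
    [Finite (kernelSubgroup Φ I)] (γ : endRingInt (quotientByPeriod Φ (kernelSubgroup Φ I))) :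
    ((e.symm (quotientEndEquivOfNeBot e hI γ) : endRingInt Φ) : Matrix ι ι ℤ).map (Int.cast : ℤ → ℚ) =
      quotientEndHom Φ (kernelSubgroup Φ I) γ := by
  rw [quotientEndEquivOfNeBot, RingEquiv.trans_apply, RingEquiv.symm_apply_apply]
  exact (isInvertibleIdeal_of_ne_bot e hI).coe_quotientEndEquiv _ γ

/-- **Every quotient `X/H(I)`, `I ≠ 0`, of a torus with Dedekind `End(X)` is a value of `quotientClass`** (so
`quotientClass` is a bijection of `ClassGroup R` onto the classes of the `X/H(I)`, `I ≠ 0`).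
[cite: Kieffer2024IsogenyGraphs, Theorem 2 ("`R` is a maximal order … principal homogeneous space under the class group `Cl(R)`") and §1.4.2 Thm. 1.4.9, pp. 2, 46] -/
theorem exists_quotientClass_eq (e : endRingInt Φ ≃+* R) {I : Ideal (endRingInt Φ)} (hI : I ≠ ⊥)
    [Finite (kernelSubgroup Φ I)] :
    ∃ c : ClassGroup R, quotientClass e c = ⟦quotientByPeriod Φ (kernelSubgroup Φ I)⟧ :=
  ⟨ClassGroup.mk (FractionRing R)
      ((isInvertibleIdeal_iff_isUnit_coeIdeal e (FractionRing R)).1 (isInvertibleIdeal_of_ne_bot e hI)).unit,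
    quotientClass_mk e (FractionRing R) (IsUnit.unit_spec _)⟩

end Dedekind

/-! ## §4′ Class number one: every `X/H(I)` is `X` -/

section PID

variable {Φ}
variable {R : Type*} [CommRing R] [IsDomain R] [IsPrincipalIdealRing R]

/-- **If `End(X) ≅ R` is a principal ideal domain (class number one), every quotient `X/H(I)`, `I ≠ 0`, is
isomorphic to `X`** (`I = End(X)α` for an isogeny `α`; "`A/H(I) ≃ A` if and only if `I` lies in the trivial
class"). [cite: Kieffer2024IsogenyGraphs, §1.4.3 (sketch of proof of Theorem 2) and §1.4.1 ("if `I` is principal, then `A/H(I)` is isomorphic to `A`"), pp. 45, 47] -/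
theorem isIsomorphic_quotient_self_of_isPrincipalIdealRing (e : endRingInt Φ ≃+* R) {I : Ideal (endRingInt Φ)}
    (hI : I ≠ ⊥) [Finite (kernelSubgroup Φ I)] : IsIsomorphic (quotientByPeriod Φ (kernelSubgroup Φ I)) Φ := by
  obtain ⟨s, hs⟩ := (IsPrincipalIdealRing.principal (I.map e)).principal
  have hs0 : s ≠ 0 := by
    intro h0
    apply hI
    apply map_injective_of_ringEquiv e
    rw [hs, Ideal.map_bot, h0]
    exact Ideal.span_singleton_eq_bot.2 rfl
  have hIeq : I = Ideal.span {e.symm s} := by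
    apply map_injective_of_ringEquiv e
    rw [hs, Ideal.map_span, Set.image_singleton, RingEquiv.apply_symm_apply]
  have hdet : ((e.symm s : endRingInt Φ) : Matrix ι ι ℤ).det ≠ 0 :=
    det_ne_zero_of_ne_zero_of_ringEquiv e ((EmbeddingLike.map_ne_zero_iff).2 hs0)
  exact (hIeq ▸ isInvertibleIdeal_span_singleton Φ hdet).isIsomorphic_quotient_self_of_eq_span hdet hIeq

end PID

end ComplexTorus

end Literature.Geometry.Kaehler
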